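/- Fleet seat `ym-wcr-19456-p1` (g3), route `WeakCouplingRates`, assembly item stmt-QuantumFields-19610. -/
import Summits.QuantumFields.YangMills.Theses.WeakCouplingRates
import Summits.QuantumFields.YangMills.Theorems.WeakCouplingRatesBulkDominatesColdBoxW

/-!
# Route `WeakCouplingRates` — the assembly item, and the rung leaf `XiPowSU2` UNCONDITIONALLY

`Summit.QuantumFields.YangMills.Theses.WeakCouplingRates.Assembly` is the registered assembly statement
`BulkDominatesColdBoxW → ColdBoxTwoPointFloorW → CurvatureCorrPowerFloor → XiPowSU2` (item stmt-QuantumFields-19610,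
rank 1 of route-QuantumFields-WeakCouplingRates, rev 2) — literally the type of the route's deciding theorem
`closes` (kernel glue `xiPowSU2_of_box`: `θ₀` from BOX_W, BULK_W instantiated at `θ₀`).  `Assembly_proof` records that
fact as a sorry-free term so the item closes by name.

All three hypotheses are PROVED in the tree — BULK_W `BulkDominatesColdBoxW_proof` (p490223, closed 2026-08-27T03:05Z),
BOX_W `ColdBoxTwoPointFloorW_proof` (p480280), FLOOR `curvatureCorrPowerFloor_proof` (p451030) — so this file also
discharges them: `xiPowSU2_holds : XiPowSU2`, the registered rung leaf R2ξ of the route, with no hypothesis.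

HONEST FRAMING: `XiPowSU2` is the rung leaf «every SU(2)₄ lattice correlation-length proxy obeys the power bound of
the leaf module `Summits/QuantumFields/YangMills/Theorems/WeakCouplingRates.lean`» (D-0061 class rung: servable and
labelled) — NOT the summit statement `YangMills` and not the Clay mass gap; nothing here is new mathematics beyond
the three closed cruxes it composes.
-/

namespace Summit.QuantumFields.YangMills.Theorems.WeakCouplingRates

/-- The assembly item of route WeakCouplingRates: BULK_W, BOX_W and FLOOR imply the rung leaf `XiPowSU2` — by the
route's deciding theorem `WeakCouplingRates.closes` (= `xiPowSU2_of_box` with `θ₀` from BOX_W and BULK_W taken at `θ₀`). -/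
theorem Assembly_proof : Summit.QuantumFields.YangMills.Theses.WeakCouplingRates.Assembly := by
  unfold Summit.QuantumFields.YangMills.Theses.WeakCouplingRates.Assembly
  intro hBulk hBox hFloor
  exact Summit.QuantumFields.YangMills.Theses.WeakCouplingRates.closes hBulk hBox hFloor

/-- **The rung leaf `XiPowSU2` of route WeakCouplingRates, unconditionally**: the assembly applied to the three
proved cruxes `BulkDominatesColdBoxW_proof`, `ColdBoxTwoPointFloorW_proof`, `curvatureCorrPowerFloor_proof`. -/
theorem xiPowSU2_holds : XiPowSU2 :=
  Assembly_proof BulkDominatesColdBoxW_proof ColdBoxTwoPointFloorW_proof curvatureCorrPowerFloor_proof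

end Summit.QuantumFields.YangMills.Theorems.WeakCouplingRates
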